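import Summits.QuantumFields.BalabanUV.T4Continuum.Support.VariationalColourTaxiTowerEndMin
import Summits.QuantumFields.BalabanUV.T4Continuum.Support.VariationalVectorEndOfLeavesAvgG

/-!
# T⁴ programme, spine node NE2 (U1a), lane P2 — «V-AVG-G AT TAXI DATA», file 1: THE RATE END WITHOUT SLICE LAW AT BAŁABAN's TAXI DATA —
# this lineage's `towerLimitRate_effV_of_leaves_avgG` (p232272: the (SLICE-min) socket REPLACED by (G″) «V-AVG-G» + V-REG at fine minimisers) at the nested
# product line transports of a COHERENT tower of UNITARY one-step bond operators, transport side inhabited; per level and under the plaquette class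
# (model level, `E = ℂ`; cell `pub-balaban`)

NE2 formalisation swarm `b2b-balaban-t4-ne2-formalise-*`, leaf prover 10 GEN 5 (`prover-b2b-balaban-t4-ne2-formalise-leaf-10-g5-0`, V-END holder lineage);
register row «P2-sup» of `t4/formal/NE2/LEAVES.md`; journal INTENT «V-AVG-G AT TAXI DATA» (CLAIMS.log 2026-08-20, ONLINE gen 5), file F1.  The TWIN of leaf-04-g5's
part 4 `VariationalColourTaxiTowerEndMin.towerLimitRate_effV_taxiTower_min(_of_class)` (p227348) with the abstract END swapped: leaf-10-g3's
`towerLimitRate_effV_of_leaves_min` (p225541) ↦ leaf-10-g4's `VariationalVectorEndOfLeavesAvgG.towerLimitRate_effV_of_leaves_avgG` (p232272).  Compositions BY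
NAME with parts 1 ∕ 2 ∕ 4 of «V-COL-TAXI-END» (`VariationalColourTaxiTowerEnd{,Class,Min}`: the one-step sockets `exists_ubV_nestLv_SfV` ∕ `qVV_le_nestLv_of_garding` ∕
`ScV_QvL_nestLv_le_curl`, the class arithmetic `deltaCurl_le_of_class`, the glue `taxiClassPackage`) and part 10 of «V-COL-TAXI-TOWER» (`exists_ubV_nestLv_ScV`,
`qWV_le_nestLv_of_garding`); nothing defined.  The proofs are part 4's with the socket lines changed.

THE CHANGED SOCKETS (w.r.t. part 4).  REMOVED: (SLICE-min)_k, its decay binders `σ, σ′ ≤ c·θ^k` — with background the located obstruction of leaf-01-g7's memo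
`t4/T4-EST-NE2-P2-VGF.md` (V1)∕(V2).  ADDED (DISPLAYED, in the taxi letters `T k := nestLv k`, `R k := Rlev k`, `T′ k := lineT (taxiTv (R′ k)) (R′ k)`):
**`hAVGG k`** — (G″) «V-AVG-G» at fine minimisers `g₀` of the level-`k` composite fibre, `((L^k)^d)⁻¹((L^k)²·G k (Q_{T′ k} g₀)) ≤ (√(((L^kL)^d)⁻¹((L^kL)²·G′ k g₀)) +
ε″ k·√(ρV′ k g₀))²` with `ε″ k ≤ c_ε″·θ^k`, and **`hREGf k`** — V-REG for the fine regularity functional `ρV′ k` at those minimisers, `CR′ k ≤ CR′⋆`.  Everything else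
(DATA, structural ∕ transport sockets, the displayed G-side (GF1′) ∕ Gårding ∕ matrix form ∕ `Gtr`, the smallness ∕ uniformity ∕ decay lines, (ONE-min)_k, V-REG_k)
VERBATIM as part 4.
 * §1 **`towerLimitRate_effV_taxiTower_avgG`** — per level, explicit smallness ∕ uniformity ∕ decay lines displayed (any `θ ∈ [0,1)`); constant
   `eV Λ⋆ (C_P⋆ + CR′⋆) (c_δ + c_ε″) + ePV Λ⋆ C_P⋆ C_R⋆ c_ε c_δ′`, `C_P⋆ = max(40κ⋆, 64 + 40κ′⋆)`, `c_δ` the explicit curl-Federbush parameter's constant;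
 * §2 **`towerLimitRate_effV_taxiTower_avgG_of_class`** — the same under the scale-invariant plaquette class `(L^{k+1})²b_k ≤ c` with part 2's three polynomial
   smallness conditions on `c`, level defects eliminated by `taxiClassPackage`, `c_δ = 2d(dc + Lc)`, rate `θ ∈ [L⁻¹,1)`.
WHAT IS NOT HERE (stated, not hidden): no G-side law is proved; (G″) and V-REG′ at taxi data for Bałaban's `projG` are the next files of this item
(`…AvgGData`: (G″) from operator data + the composite ↔ straight-taxi kernel swap with coefficient one; `…AvgGReg`: V-REG′ by transport of the level-(k+1) sockets);
(ONE-min)_k with background stays displayed (leaf-04-g7's bridge `hONEm_taxi_of_centred` + leaf-01-g9's `hONEm_centred_reg` are its suppliers of record).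

HONEST FRAMING (T4-DAG p. 1).  Composition at MODEL level (`E = ℂ`; bond operators DATA; taxi ∕ straight contours OURS; [Balaban1985BackgroundPropagators]
(3.10)∕(3.15)∕(3.19), [Balaban1985AveragingOperations] (125) SHAPES only, no B0, c5); nothing printed is a hypothesis; no `def`, no `def … : Prop`, no `sorry`;
axioms standard.  (G″) ∕ V-REG′ ∕ (ONE-min) ∕ V-REG ∕ the G-side DISPLAYED ⟹ V-END with background NOT proved; NE2 NOT proved on either road; NE3 OPEN; spine PROVED
0∕9 unchanged; rung (B)+1 finite T⁴ — NOT infinite volume, NOT mass gap, NOT Clay.  HONEST DEPENDENCY (cell, verbatim): continuum YM on T⁴ ⇐ BetaPertH ∧ nine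
spine estimates (0/9 proved); BetaPertH ⇐ (D1) ∧ (D4) ∧ CAP+tail; G-an2-4 gates asym, D1 and NE2/3/4.
-/

noncomputable section

namespace Summit.QuantumFields.BalabanUV.T4Continuum.VariationalColourTaxiTowerEndAvgG

open Finset
open scoped Matrix ComplexOrder BigOperators
open Literature.MathematicalPhysics.QuantumFieldTheory.Balaban1983to89.B5Prop11Plancherel (Tor fine unitVec)
open Literature.Analysis.Complex (qform)
open Summit.QuantumFields.BalabanUV.T4Continuum.VariationalTransfer (blockSpin)
open Summit.QuantumFields.BalabanUV.T4Continuum.VariationalColourFederbush (norm_le_one_of_mem_unitary)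
open Summit.QuantumFields.BalabanUV.T4Continuum.VariationalColourTower (Rtrv)
open Summit.QuantumFields.BalabanUV.T4Continuum.VariationalColourTaxiTransport
open Summit.QuantumFields.BalabanUV.T4Continuum.VariationalVectorFederbush (lineT)
open Summit.QuantumFields.BalabanUV.T4Continuum.CovariantAveragingTower (TowerLimitRate)
open Summit.QuantumFields.BalabanUV.T4Continuum.VectorBlockTrialForm (nsqV nsqV_nonneg QvL roughV kappaV)
open Summit.QuantumFields.BalabanUV.T4Continuum.VariationalVectorForm (ScV SfV qWV qVV lamV lamV_nonneg ScV_nonneg)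
open Summit.QuantumFields.BalabanUV.T4Continuum.VariationalVectorEffective (unc effV)
open Summit.QuantumFields.BalabanUV.T4Continuum.VariationalVectorTower (Gtr QmL SfV_eq_transport)
open Summit.QuantumFields.BalabanUV.T4Continuum.VariationalVectorEndOfLeaves (eV ePV nonneg_of_qform)
open Summit.QuantumFields.BalabanUV.T4Continuum.VariationalVectorEndOfLeavesAvgG (towerLimitRate_effV_of_leaves_avgG)

variable {d : ℕ}

/-! ## §1 The END-avgG at taxi data, per-level lines displayed -/

section End

variable (L : ℕ) [NeZero L] (M : Fin d → ℕ) [hM : ∀ μ, NeZero (M μ)]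
variable {R' : (k : ℕ) → Tor (fine L (fine (L ^ k) M)) → Fin d → (ℂ →L[ℂ] ℂ)}
variable (Gm : (k : ℕ) → Matrix (Tor (fine (L ^ k) M) × Fin d) (Tor (fine (L ^ k) M) × Fin d) ℂ)
variable (G : (k : ℕ) → (Tor (fine (L ^ k) M) → Fin d → ℂ) → ℝ)
variable (G' : (k : ℕ) → (Tor (fine L (fine (L ^ k) M)) → Fin d → ℂ) → ℝ)

/-- **THE END-avgG AT BAŁABAN's TAXI DATA** — leaf-10-g4's `towerLimitRate_effV_of_leaves_avgG` (p232272) at `T k := nestLv k`, `R k := Rlev k`,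
`T′ k := lineT (taxiTv (R′ k)) (R′ k)`: as part 4's `towerLimitRate_effV_taxiTower_min` (same DATA, same discharged structural ∕ transport sockets `hTcomp`∕`hRtr`∕
`hUBc`∕`hUBf`∕`hPc`∕`hPf`∕`hFEDcurl`, same displayed G-side, smallness ∕ uniformity ∕ decay lines, (ONE-min)_k and V-REG_k) with the (SLICE-min) socket and its costs
`σ, σ′` REMOVED and two sockets ADDED: **(G″)_k** `hAVGG` at fine minimisers of the composite fibre (square-root shape, coefficient one, `ε″ k ≤ c_ε″·θ^k`) and
**V-REG′_k** `hREGf` for the fine regularity functional `ρV′ k` there (`CR′ k ≤ CR′⋆`).  Constant `eV Λ⋆ (C_P⋆ + CR′⋆) (c_δ + c_ε″) + ePV Λ⋆ C_P⋆ C_R⋆ c_ε c_δ′`,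
`C_P⋆ = max(40κ⋆, 64 + 40κ′⋆)` (`aa` = the END's parameter `a`). [folklore] -/
theorem towerLimitRate_effV_taxiTower_avgG (hd : 1 ≤ d) (hM2 : ∀ μ, 1 < M μ)
    -- the one-step bond data: unitary, plaquette defects (one-step `b`, level `a`), coherent
    (hU : ∀ k x μ, R' k x μ ∈ unitary (ℂ →L[ℂ] ℂ)) {b a : ℕ → ℝ}
    (hb : ∀ k x κ ι, ‖R' k x κ * R' k (x + unitVec (fine L (fine (L ^ k) M)) κ) ι - R' k x ι * R' k (x + unitVec (fine L (fine (L ^ k) M)) ι) κ‖ ≤ b k)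
    (ha0 : ∀ k, 0 ≤ a k)
    (ha : ∀ k x κ ι, ‖Rlev L M R' k x κ * Rlev L M R' k (x + unitVec (fine (L ^ k) M) κ) ι - Rlev L M R' k x ι * Rlev L M R' k (x + unitVec (fine (L ^ k) M) ι) κ‖ ≤ a k)
    (hcoh : ∀ k, coarseTv L (fine (L ^ (k + 1)) M) (R' (k + 1)) = Rtrv (L ^ k) L M (R' k))
    -- the G-side (DISPLAYED): matrix form, transport identity, (GF1′), the Gårding half
    (hGm : ∀ k, (Gm k).PosSemidef) (hG : ∀ k W, G k W = qform (Gm k) (unc W)) (hGtr : ∀ k, G (k + 1) = Gtr (L ^ k) L M (G' k))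
    {CG C₀ κg κg' : ℕ → ℝ} {κs κs' : ℝ} (hCG : ∀ k, 0 ≤ CG k) (hC₀ : ∀ k, 0 ≤ C₀ k) (hκg' : ∀ k, 0 ≤ κg' k) (hκs : ∀ k, κg k ≤ κs) (hκs' : ∀ k, κg' k ≤ κs')
    (hGF : ∀ k W, G k W ≤ CG k * roughV (L ^ k) M (Rlev L M R' k) W + C₀ k * nsqV (fine (L ^ k) M) W)
    (hGar : ∀ k W, ((((L ^ k : ℕ) : ℝ)) ^ d)⁻¹ * ((((L ^ k : ℕ) : ℝ)) ^ 2 * roughV (L ^ k) M (Rlev L M R' k) W)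
      ≤ κg k * ScV (L ^ k) M (Rlev L M R' k) (G k) W + κg' k * nsqV M (QvL (L ^ k) M (nestLv L M R' k) W))
    -- the per-level smallness lines of parts 5 ∕ 10 (discharged under the plaquette class in §2)
    (hcUB : ∀ k, (kappaV d (L ^ k))⁻¹ * ((∑ q ∈ Finset.range k, ((((d - 1 : ℕ) : ℝ) + (d : ℝ) * d) * (((L : ℝ) * ((L ^ q - 1 : ℕ) : ℝ) * ((L - 1 : ℕ) : ℝ)) * b q)))
        + 3 * (((d - 1 : ℕ) : ℝ) * (L ^ k : ℕ) * ((L ^ k - 1 : ℕ) : ℝ) * a k)) < 1)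
    (hsmallP : ∀ k, 2 * (d : ℝ) * ((((L ^ k : ℕ) : ℝ)) * (((d - 1 : ℕ) : ℝ) * ((L ^ k - 1 : ℕ) : ℝ) * a k)) ^ 2 ≤ 1 / 2)
    (hγs : ∀ k, 64 * (∑ q ∈ Finset.range k, ((((d - 1 : ℕ) : ℝ) + (d : ℝ) * d) * (((L : ℝ) * ((L ^ q - 1 : ℕ) : ℝ) * ((L - 1 : ℕ) : ℝ)) * b q))) ^ 2 ≤ 1)
    -- rate, uniformity of the explicit V-UB constant, decay of the explicit curl-Federbush parameter
    {aa : ℝ} (haa : 0 < aa) {θ Λs cδ : ℝ} (hθ : 0 ≤ θ) (hθ1 : θ < 1)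
    (hΛs : ∀ k, lamV d ((L ^ k : ℕ) * (((d - 1 : ℕ) : ℝ) * ((L ^ k - 1 : ℕ) : ℝ) * a k)) (CG k) (((L ^ k : ℕ) : ℝ) ^ 2 * C₀ k)
      / (1 - (kappaV d (L ^ k))⁻¹ * ((∑ q ∈ Finset.range k, ((((d - 1 : ℕ) : ℝ) + (d : ℝ) * d) * (((L : ℝ) * ((L ^ q - 1 : ℕ) : ℝ) * ((L - 1 : ℕ) : ℝ)) * b q)))
          + 3 * (((d - 1 : ℕ) : ℝ) * (L ^ k : ℕ) * ((L ^ k - 1 : ℕ) : ℝ) * a k))) ^ 2 ≤ Λs)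
    (hδθ : ∀ k, (d : ℝ) * ((((L ^ k : ℕ)) : ℝ) * (2 * (((d - 1 : ℕ) : ℝ) * L * ((L - 1 : ℕ) : ℝ) * b k + L * L * b k) + 2 * L * (L * L * b k))) ≤ cδ * θ ^ k)
    -- LOWER side (DISPLAYED): (G″) «V-AVG-G» and V-REG′ AT FINE MINIMISERS OF THE COMPOSITE FIBRE
    (CR' ε'' : ℕ → ℝ) {CRs' cε'' : ℝ} (hCR' : ∀ k, 0 ≤ CR' k) (hCRs' : ∀ k, CR' k ≤ CRs') (hε'' : ∀ k, 0 ≤ ε'' k) (hε''θ : ∀ k, ε'' k ≤ cε'' * θ ^ k)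
    {ρV' : (k : ℕ) → (Tor (fine L (fine (L ^ k) M)) → Fin d → ℂ) → ℝ}
    (hAVGG : ∀ k (φ : Tor M → Fin d → ℂ) (g₀ : Tor (fine L (fine (L ^ k) M)) → Fin d → ℂ),
      QvL (L ^ k) M (nestLv L M R' k) (QvL L (fine (L ^ k) M) (lineT L (fine (L ^ k) M) (taxiTv L (fine (L ^ k) M) (R' k)) (R' k)) g₀) = φ →
      (∀ W', QvL (L ^ k) M (nestLv L M R' k) (QvL L (fine (L ^ k) M) (lineT L (fine (L ^ k) M) (taxiTv L (fine (L ^ k) M) (R' k)) (R' k)) W') = φ →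
        SfV (L ^ k) L M (R' k) (G' k) g₀ ≤ SfV (L ^ k) L M (R' k) (G' k) W') →
      ((((L ^ k : ℕ) : ℝ)) ^ d)⁻¹ * ((((L ^ k : ℕ) : ℝ)) ^ 2 * G k (QvL L (fine (L ^ k) M) (lineT L (fine (L ^ k) M) (taxiTv L (fine (L ^ k) M) (R' k)) (R' k)) g₀))
        ≤ (Real.sqrt (((((L ^ k : ℕ) : ℝ) * L) ^ d)⁻¹ * (((((L ^ k : ℕ) : ℝ)) * L) ^ 2 * G' k g₀)) + ε'' k * Real.sqrt (ρV' k g₀)) ^ 2)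
    (hREGf : ∀ k (φ : Tor M → Fin d → ℂ) (g : Tor (fine L (fine (L ^ k) M)) → Fin d → ℂ),
      QvL (L ^ k) M (nestLv L M R' k) (QvL L (fine (L ^ k) M) (lineT L (fine (L ^ k) M) (taxiTv L (fine (L ^ k) M) (R' k)) (R' k)) g) = φ →
      (∀ W', QvL (L ^ k) M (nestLv L M R' k) (QvL L (fine (L ^ k) M) (lineT L (fine (L ^ k) M) (taxiTv L (fine (L ^ k) M) (R' k)) (R' k)) W') = φ →
        SfV (L ^ k) L M (R' k) (G' k) g ≤ SfV (L ^ k) L M (R' k) (G' k) W') →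
      ρV' k g ≤ CR' k * (SfV (L ^ k) L M (R' k) (G' k) g + nsqV M φ))
    -- UPPER side (DISPLAYED): leaf V-ONE for the FULL fine form at coarse minimisers and leaf V-REG
    (CR ε₁ δ' : ℕ → ℝ) {CRs cε cδ' : ℝ} (hCR : ∀ k, 0 ≤ CR k) (hCRs : ∀ k, CR k ≤ CRs) (hε₁ : ∀ k, 0 ≤ ε₁ k) (hδ' : ∀ k, 0 ≤ δ' k)
    (hεθ : ∀ k, ε₁ k ≤ cε * θ ^ k) (hδ'θ : ∀ k, δ' k ≤ cδ' * θ ^ k)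
    {ρV : (k : ℕ) → (Tor (fine (L ^ k) M) → Fin d → ℂ) → ℝ} (hρ0 : ∀ k W, 0 ≤ ρV k W)
    (hONEm : ∀ k (φ : Tor M → Fin d → ℂ) (W₀ : Tor (fine (L ^ k) M) → Fin d → ℂ), QvL (L ^ k) M (nestLv L M R' k) W₀ = φ →
      (∀ W, QvL (L ^ k) M (nestLv L M R' k) W = φ → ScV (L ^ k) M (Rlev L M R' k) (G k) W₀ ≤ ScV (L ^ k) M (Rlev L M R' k) (G k) W) →
      ∃ g, QvL (L ^ k) M (nestLv L M R' k) (QvL L (fine (L ^ k) M) (lineT L (fine (L ^ k) M) (taxiTv L (fine (L ^ k) M) (R' k)) (R' k)) g) = φ ∧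
        SfV (L ^ k) L M (R' k) (G' k) g ≤ (Real.sqrt (ScV (L ^ k) M (Rlev L M R' k) (G k) W₀ + ε₁ k * ρV k W₀) + δ' k * Real.sqrt (qWV (L ^ k) M W₀)) ^ 2)
    (hREG : ∀ k (φ : Tor M → Fin d → ℂ) W, QvL (L ^ k) M (nestLv L M R' k) W = φ →
      (∀ W₂, QvL (L ^ k) M (nestLv L M R' k) W₂ = φ → ScV (L ^ k) M (Rlev L M R' k) (G k) W ≤ ScV (L ^ k) M (Rlev L M R' k) (G k) W₂) →
      ρV k W ≤ CR k * (ScV (L ^ k) M (Rlev L M R' k) (G k) W + nsqV M φ)) :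
    TowerLimitRate (ι := fun _ => Tor M × Fin d) (fun _ => (1 : Matrix (Tor M × Fin d) (Tor M × Fin d) ℂ)) 1
      (fun k => effV (L ^ k) M (Rlev L M R' k) (Gm k) (QmL (L ^ k) M (nestLv L M R' k)) aa)
      (eV Λs (max (40 * κs) (64 + 40 * κs') + CRs') (cδ + cε'') + ePV Λs (max (40 * κs) (64 + 40 * κs')) CRs cε cδ') θ := by
  -- (GF0) at every level from the matrix form; at level `k+1` read through `Gtr`
  have hG0 : ∀ k W, 0 ≤ G k W := fun k => nonneg_of_qform (L ^ k) M (hGm k) (hG k)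
  have hG0tr : ∀ k W, 0 ≤ Gtr (L ^ k) L M (G' k) W := fun k W => by rw [← hGtr k]; exact hG0 (k + 1) W
  have hGFtr : ∀ k W, Gtr (L ^ k) L M (G' k) W ≤ CG (k + 1) * roughV (L ^ (k + 1)) M (Rlev L M R' (k + 1)) W + C₀ (k + 1) * nsqV (fine (L ^ (k + 1)) M) W :=
    fun k W => by rw [← hGtr k]; exact hGF (k + 1) W
  have hGartr : ∀ k W, ((((L ^ (k + 1) : ℕ) : ℝ)) ^ d)⁻¹ * ((((L ^ (k + 1) : ℕ) : ℝ)) ^ 2 * roughV (L ^ (k + 1)) M (Rlev L M R' (k + 1)) W)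
      ≤ κg (k + 1) * ScV (L ^ (k + 1)) M (Rlev L M R' (k + 1)) (Gtr (L ^ k) L M (G' k)) W
        + κg' (k + 1) * nsqV M (QvL (L ^ (k + 1)) M (nestLv L M R' (k + 1)) W) := fun k W => by rw [← hGtr k]; exact hGar (k + 1) W
  have hb0 : ∀ k, 0 ≤ b k := fun k => (norm_nonneg _).trans (hb k 0 ⟨0, hd⟩ ⟨0, hd⟩)
  -- the explicit V-UB constants `Λ_k` and their nonnegativity
  set Λ : ℕ → ℝ := fun k => lamV d ((L ^ k : ℕ) * (((d - 1 : ℕ) : ℝ) * ((L ^ k - 1 : ℕ) : ℝ) * a k)) (CG k) (((L ^ k : ℕ) : ℝ) ^ 2 * C₀ k)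
      / (1 - (kappaV d (L ^ k))⁻¹ * ((∑ q ∈ Finset.range k, ((((d - 1 : ℕ) : ℝ) + (d : ℝ) * d) * (((L : ℝ) * ((L ^ q - 1 : ℕ) : ℝ) * ((L - 1 : ℕ) : ℝ)) * b q)))
          + 3 * (((d - 1 : ℕ) : ℝ) * (L ^ k : ℕ) * ((L ^ k - 1 : ℕ) : ℝ) * a k))) ^ 2 with hΛdef
  have hΛ0 : ∀ k, 0 ≤ Λ k := fun k => div_nonneg (lamV_nonneg (hCG k) (by have := hC₀ k; positivity)) (sq_nonneg _)
  have hΛs0 : 0 ≤ Λs := (hΛ0 0).trans (hΛs 0)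
  -- the uniform V-P constant
  set CPs : ℝ := max (40 * κs) (64 + 40 * κs') with hCPs
  have hCPk : ∀ k, max (40 * κg k) (64 + 40 * κg' k) ≤ CPs := fun k => max_le_max (by linarith [hκs k]) (by linarith [hκs' k])
  have hCPk0 : ∀ k, 0 ≤ max (40 * κg k) (64 + 40 * κg' k) := fun k => le_max_of_le_right (by linarith [hκg' k])
  have hCPs0 : 0 ≤ CPs := (hCPk0 0).trans (hCPk 0)
  -- leaf V-UB at both levels (part 10 ∕ part 1), weakened to the uniform constant
  have hUBc : ∀ k (φ : Tor M → Fin d → ℂ), ∃ W, QvL (L ^ k) M (nestLv L M R' k) W = φ ∧ ScV (L ^ k) M (Rlev L M R' k) (G k) W ≤ Λs * nsqV M φ :=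
    fun k φ => by
    obtain ⟨W, hW, hS⟩ := exists_ubV_nestLv_ScV L M hU hb hcoh k (ha0 k) (ha k) hd (hcUB k) (hCG k) (hC₀ k) (hGF k) φ
    exact ⟨W, hW, hS.trans (mul_le_mul_of_nonneg_right (hΛs k) (nsqV_nonneg M φ))⟩
  have hUBf : ∀ k (φ : Tor M → Fin d → ℂ), ∃ W', QvL (L ^ k) M (nestLv L M R' k)
      (QvL L (fine (L ^ k) M) (lineT L (fine (L ^ k) M) (taxiTv L (fine (L ^ k) M) (R' k)) (R' k)) W') = φ ∧
      SfV (L ^ k) L M (R' k) (G' k) W' ≤ Λs * nsqV M φ := fun k φ => by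
    obtain ⟨W', hW', hS⟩ := exists_ubV_nestLv_SfV L M hU hb hcoh hd k (ha0 (k + 1)) (ha (k + 1)) (hcUB (k + 1)) (hCG (k + 1)) (hC₀ (k + 1)) (hGFtr k) φ
    exact ⟨W', hW', hS.trans (mul_le_mul_of_nonneg_right (hΛs (k + 1)) (nsqV_nonneg M φ))⟩
  -- leaf V-P at both levels modulo the Gårding halves (part 10 ∕ part 1), weakened to the uniform constant
  have hPc : ∀ k W, qWV (L ^ k) M W ≤ CPs * (ScV (L ^ k) M (Rlev L M R' k) (G k) W + nsqV M (QvL (L ^ k) M (nestLv L M R' k) W)) := fun k W => by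
    have h := qWV_le_nestLv_of_garding L M hU hb hcoh hM2 k (ha k) (hsmallP k) (hγs k) (hG0 k) (hGar k) W
    exact h.trans (mul_le_mul_of_nonneg_right (hCPk k) (add_nonneg (ScV_nonneg (L ^ k) M _ (hG0 k) W) (nsqV_nonneg M _)))
  have hPf : ∀ k W', qVV (L ^ k) L M W' ≤ CPs * (SfV (L ^ k) L M (R' k) (G' k) W'
      + nsqV M (QvL (L ^ k) M (nestLv L M R' k) (QvL L (fine (L ^ k) M) (lineT L (fine (L ^ k) M) (taxiTv L (fine (L ^ k) M) (R' k)) (R' k)) W'))) :=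
    fun k W' => by
    have h := qVV_le_nestLv_of_garding L M hU hb hcoh hM2 k (ha (k + 1)) (hsmallP (k + 1)) (hγs (k + 1)) (hG0tr k) (hGartr k) W'
    refine h.trans (mul_le_mul_of_nonneg_right (hCPk (k + 1)) (add_nonneg ?_ (nsqV_nonneg M _)))
    rw [SfV_eq_transport]
    exact ScV_nonneg (L ^ k * L) M _ (hG0tr k) _
  -- the END of leaf-10-g4, fed
  exact towerLimitRate_effV_of_leaves_avgG L M (Rlev L M R') R' Gm G G' (nestLv L M R')
    (fun k => lineT L (fine (L ^ k) M) (taxiTv L (fine (L ^ k) M) (R' k)) (R' k)) hGm hG (fun k => rfl) (fun k => rfl) hGtr haa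
    (fun _ => Λs) (fun _ => CPs) CR CR'
    (fun k => (d : ℝ) * ((((L ^ k : ℕ)) : ℝ) * (2 * (((d - 1 : ℕ) : ℝ) * L * ((L - 1 : ℕ) : ℝ) * b k + L * L * b k) + 2 * L * (L * L * b k))))
    ε₁ δ' ε'' (fun _ => hΛs0) (fun _ => le_rfl) (fun _ => hCPs0) (fun _ => le_rfl) hCR hCRs hCR' hCRs'
    (fun k => by have := hb0 k; positivity) hε₁ hδ' hε'' hθ hθ1 hδθ hεθ hδ'θ hε''θ hρ0 hUBc hUBf hPc hPf
    (fun k W' => ScV_QvL_nestLv_le_curl L M hU hb hcoh k (hb0 k) W') hAVGG hREGf hONEm hREG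

end End

/-! ## §2 The END-avgG at taxi data under the scale-invariant plaquette class -/

section EndClass

variable (L : ℕ) [NeZero L] (M : Fin d → ℕ) [hM : ∀ μ, NeZero (M μ)]
variable {R' : (k : ℕ) → Tor (fine L (fine (L ^ k) M)) → Fin d → (ℂ →L[ℂ] ℂ)}
variable (Gm : (k : ℕ) → Matrix (Tor (fine (L ^ k) M) × Fin d) (Tor (fine (L ^ k) M) × Fin d) ℂ)
variable (G : (k : ℕ) → (Tor (fine (L ^ k) M) → Fin d → ℂ) → ℝ)
variable (G' : (k : ℕ) → (Tor (fine L (fine (L ^ k) M)) → Fin d → ℂ) → ℝ)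

/-- **THE END-avgG AT BAŁABAN's TAXI DATA UNDER THE SCALE-INVARIANT PLAQUETTE CLASS** — part 4's `towerLimitRate_effV_taxiTower_min_of_class` with the
(SLICE-min) socket and its costs REMOVED and (G″)_k ∕ V-REG′_k ADDED (displayed); everything else (DATA, class `(L^{k+1})²b_k ≤ c`, the three polynomial smallness
conditions on `c`, the displayed G-side, (ONE-min)_k and V-REG_k, `Λ⋆ = 4·lamV d ((d−1)c) C_G⋆ c₀`, `C_P⋆`, `c_δ = 2d(dc + Lc)`, rate `θ ∈ [L⁻¹,1)`) VERBATIM;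
constant `eV Λ⋆ (C_P⋆ + CR′⋆) (c_δ + c_ε″) + ePV Λ⋆ C_P⋆ C_R⋆ c_ε c_δ′`. [folklore] -/
theorem towerLimitRate_effV_taxiTower_avgG_of_class (hL : 2 ≤ L) (hd : 1 ≤ d) (hM2 : ∀ μ, 1 < M μ)
    -- the one-step bond data: unitary, plaquette class, coherent
    (hU : ∀ k x μ, R' k x μ ∈ unitary (ℂ →L[ℂ] ℂ)) {b : ℕ → ℝ} {c : ℝ}
    (hb : ∀ k x κ ι, ‖R' k x κ * R' k (x + unitVec (fine L (fine (L ^ k) M)) κ) ι - R' k x ι * R' k (x + unitVec (fine L (fine (L ^ k) M)) ι) κ‖ ≤ b k)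
    (hbc : ∀ k, (((L ^ (k + 1) : ℕ)) : ℝ) ^ 2 * b k ≤ c)
    (hcoh : ∀ k, coarseTv L (fine (L ^ (k + 1)) M) (R' (k + 1)) = Rtrv (L ^ k) L M (R' k))
    -- the polynomial smallness of the class constant
    (hsm1 : 60 * (6 : ℝ) ^ (d - 1) * ((2 * ((((d - 1 : ℕ) : ℝ) + (d : ℝ) * d)) + 3 * ((d - 1 : ℕ) : ℝ)) * c) ≤ 1 / 2)
    (hsm2 : 2 * (d : ℝ) * ((((d - 1 : ℕ) : ℝ)) * c) ^ 2 ≤ 1 / 2) (hsm3 : 64 * (2 * ((((d - 1 : ℕ) : ℝ) + (d : ℝ) * d) * c)) ^ 2 ≤ 1)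
    -- the G-side (DISPLAYED): matrix form, transport identity, (GF1′) in the class, the Gårding half
    (hGm : ∀ k, (Gm k).PosSemidef) (hG : ∀ k W, G k W = qform (Gm k) (unc W)) (hGtr : ∀ k, G (k + 1) = Gtr (L ^ k) L M (G' k))
    {CG C₀ κg κg' : ℕ → ℝ} {CGs c₀ κs κs' : ℝ} (hCG : ∀ k, 0 ≤ CG k) (hCGs : ∀ k, CG k ≤ CGs) (hC₀ : ∀ k, 0 ≤ C₀ k)
    (hC₀c : ∀ k, (((L ^ k : ℕ)) : ℝ) ^ 2 * C₀ k ≤ c₀) (hκg' : ∀ k, 0 ≤ κg' k) (hκs : ∀ k, κg k ≤ κs) (hκs' : ∀ k, κg' k ≤ κs')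
    (hGF : ∀ k W, G k W ≤ CG k * roughV (L ^ k) M (Rlev L M R' k) W + C₀ k * nsqV (fine (L ^ k) M) W)
    (hGar : ∀ k W, ((((L ^ k : ℕ) : ℝ)) ^ d)⁻¹ * ((((L ^ k : ℕ) : ℝ)) ^ 2 * roughV (L ^ k) M (Rlev L M R' k) W)
      ≤ κg k * ScV (L ^ k) M (Rlev L M R' k) (G k) W + κg' k * nsqV M (QvL (L ^ k) M (nestLv L M R' k) W))
    -- the rate
    {aa : ℝ} (haa : 0 < aa) {θ : ℝ} (hθL : (L : ℝ)⁻¹ ≤ θ) (hθ1 : θ < 1)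
    -- LOWER side (DISPLAYED): (G″)_k «V-AVG-G» and V-REG′_k at fine minimisers of the composite fibre, decaying `ε″`
    (CR' ε'' : ℕ → ℝ) {CRs' cε'' : ℝ} (hCR' : ∀ k, 0 ≤ CR' k) (hCRs' : ∀ k, CR' k ≤ CRs') (hε'' : ∀ k, 0 ≤ ε'' k) (hε''θ : ∀ k, ε'' k ≤ cε'' * θ ^ k)
    {ρV' : (k : ℕ) → (Tor (fine L (fine (L ^ k) M)) → Fin d → ℂ) → ℝ}
    (hAVGG : ∀ k (φ : Tor M → Fin d → ℂ) (g₀ : Tor (fine L (fine (L ^ k) M)) → Fin d → ℂ),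
      QvL (L ^ k) M (nestLv L M R' k) (QvL L (fine (L ^ k) M) (lineT L (fine (L ^ k) M) (taxiTv L (fine (L ^ k) M) (R' k)) (R' k)) g₀) = φ →
      (∀ W', QvL (L ^ k) M (nestLv L M R' k) (QvL L (fine (L ^ k) M) (lineT L (fine (L ^ k) M) (taxiTv L (fine (L ^ k) M) (R' k)) (R' k)) W') = φ →
        SfV (L ^ k) L M (R' k) (G' k) g₀ ≤ SfV (L ^ k) L M (R' k) (G' k) W') →
      ((((L ^ k : ℕ) : ℝ)) ^ d)⁻¹ * ((((L ^ k : ℕ) : ℝ)) ^ 2 * G k (QvL L (fine (L ^ k) M) (lineT L (fine (L ^ k) M) (taxiTv L (fine (L ^ k) M) (R' k)) (R' k)) g₀))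
        ≤ (Real.sqrt (((((L ^ k : ℕ) : ℝ) * L) ^ d)⁻¹ * (((((L ^ k : ℕ) : ℝ)) * L) ^ 2 * G' k g₀)) + ε'' k * Real.sqrt (ρV' k g₀)) ^ 2)
    (hREGf : ∀ k (φ : Tor M → Fin d → ℂ) (g : Tor (fine L (fine (L ^ k) M)) → Fin d → ℂ),
      QvL (L ^ k) M (nestLv L M R' k) (QvL L (fine (L ^ k) M) (lineT L (fine (L ^ k) M) (taxiTv L (fine (L ^ k) M) (R' k)) (R' k)) g) = φ →
      (∀ W', QvL (L ^ k) M (nestLv L M R' k) (QvL L (fine (L ^ k) M) (lineT L (fine (L ^ k) M) (taxiTv L (fine (L ^ k) M) (R' k)) (R' k)) W') = φ →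
        SfV (L ^ k) L M (R' k) (G' k) g ≤ SfV (L ^ k) L M (R' k) (G' k) W') →
      ρV' k g ≤ CR' k * (SfV (L ^ k) L M (R' k) (G' k) g + nsqV M φ))
    -- UPPER side (DISPLAYED): leaf V-ONE for the FULL fine form at coarse minimisers and leaf V-REG
    (CR ε₁ δ' : ℕ → ℝ) {CRs cε cδ' : ℝ} (hCR : ∀ k, 0 ≤ CR k) (hCRs : ∀ k, CR k ≤ CRs) (hε₁ : ∀ k, 0 ≤ ε₁ k) (hδ' : ∀ k, 0 ≤ δ' k)
    (hεθ : ∀ k, ε₁ k ≤ cε * θ ^ k) (hδ'θ : ∀ k, δ' k ≤ cδ' * θ ^ k)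
    {ρV : (k : ℕ) → (Tor (fine (L ^ k) M) → Fin d → ℂ) → ℝ} (hρ0 : ∀ k W, 0 ≤ ρV k W)
    (hONEm : ∀ k (φ : Tor M → Fin d → ℂ) (W₀ : Tor (fine (L ^ k) M) → Fin d → ℂ), QvL (L ^ k) M (nestLv L M R' k) W₀ = φ →
      (∀ W, QvL (L ^ k) M (nestLv L M R' k) W = φ → ScV (L ^ k) M (Rlev L M R' k) (G k) W₀ ≤ ScV (L ^ k) M (Rlev L M R' k) (G k) W) →
      ∃ g, QvL (L ^ k) M (nestLv L M R' k) (QvL L (fine (L ^ k) M) (lineT L (fine (L ^ k) M) (taxiTv L (fine (L ^ k) M) (R' k)) (R' k)) g) = φ ∧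
        SfV (L ^ k) L M (R' k) (G' k) g ≤ (Real.sqrt (ScV (L ^ k) M (Rlev L M R' k) (G k) W₀ + ε₁ k * ρV k W₀) + δ' k * Real.sqrt (qWV (L ^ k) M W₀)) ^ 2)
    (hREG : ∀ k (φ : Tor M → Fin d → ℂ) W, QvL (L ^ k) M (nestLv L M R' k) W = φ →
      (∀ W₂, QvL (L ^ k) M (nestLv L M R' k) W₂ = φ → ScV (L ^ k) M (Rlev L M R' k) (G k) W ≤ ScV (L ^ k) M (Rlev L M R' k) (G k) W₂) →
      ρV k W ≤ CR k * (ScV (L ^ k) M (Rlev L M R' k) (G k) W + nsqV M φ)) :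
    TowerLimitRate (ι := fun _ => Tor M × Fin d) (fun _ => (1 : Matrix (Tor M × Fin d) (Tor M × Fin d) ℂ)) 1
      (fun k => effV (L ^ k) M (Rlev L M R' k) (Gm k) (QmL (L ^ k) M (nestLv L M R' k)) aa)
      (eV (4 * lamV d (((d - 1 : ℕ) : ℝ) * c) CGs c₀) (max (40 * κs) (64 + 40 * κs') + CRs') (2 * d * ((d : ℝ) * c + L * c) + cε'')
        + ePV (4 * lamV d (((d - 1 : ℕ) : ℝ) * c) CGs c₀) (max (40 * κs) (64 + 40 * κs')) CRs cε cδ') θ := by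
  have hθ0 : 0 ≤ θ := le_trans (by positivity) hθL
  have hb0 : ∀ k, 0 ≤ b k := fun k => (norm_nonneg _).trans (hb k 0 ⟨0, hd⟩ ⟨0, hd⟩)
  obtain ⟨a, ha0, ha, -, hκγ, hsmallP, hγs, -, hΛk⟩ := taxiClassPackage L M hL hd hU hb hbc hsm1 hsm2 hsm3 hCG hCGs hC₀ hC₀c
  exact towerLimitRate_effV_taxiTower_avgG L M Gm G G' hd hM2 hU hb ha0 ha hcoh hGm hG hGtr hCG hC₀ hκg' hκs hκs' hGF hGar
    (fun k => lt_of_le_of_lt (hκγ k) (by norm_num)) hsmallP hγs haa hθ0 hθ1 hΛk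
    (fun k => deltaCurl_le_of_class (d := d) L hL hd k (hb0 k) (hbc k) hθL) CR' ε'' hCR' hCRs' hε'' hε''θ hAVGG hREGf
    CR ε₁ δ' hCR hCRs hε₁ hδ' hεθ hδ'θ hρ0 hONEm hREG

end EndClass

end Summit.QuantumFields.BalabanUV.T4Continuum.VariationalColourTaxiTowerEndAvgG

end
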